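/-
Origin: expansion seat `prover-pub-hodgecm-mc-binder-2-g13-0`, handover #73 2026-08-20T08:07Z md5 7608fe6cd35a (187 l.; 15 s; imports #72; (V-val) AS AN IDENTITY OF CHARACTERS OF THE LETTERS: homs `VLetterFam V →* ℂˣ` `kPairLetters`, **`etaLetters η`** (= η ∘ kPair ∘ lettInv), **`charLetters`** (= Circle.toUnits ∘ pinLetterChar ∘ kVLettersHom), **`kappaLetters`** (= archKappa ∘ lettInv), `vcMatrix_mul'`, `dVIota_mul`, `dVIota_ne_zero`, **`dVIotaLetters`** (a ↦ dVIota (a v₁) as a character); **`hκ_iff_letters`**: E's `hκ` (∀ k ∈ K_∞, verbatim) ↔ `etaLetters η · charLetters · dVIotaLetters = kappaLetters`; **`hκ_of_iota_of_type`**: at `η = cmDetTwistChar (χV∘det)(χW∘det)`, `HasArchType χV nV`, IF `nV (cmPlaceOver b).1 = −pairVacExponent b` at every real b ≠ v₁ AND `hκ₁` := the identity on the ι₁-letters `lettInv (mulSingle v₁ x)`, `x ∈ U(V⁺_{v₁})×U(V⁻_{v₁})`, THEN `hκ` holds for ALL `k ∈ K_∞` (Mathlib `MonoidHom.pi_ext`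 + #72); so (V-val) = {hκ₁ (one identity of characters of U(2)×U(1) at ι₁), the (S-norm) type equations off ι₁}; NAME LIST `HodgeCM.Model.HypCensus.hκ_of_iota_of_type` · `….hκ_iff_letters` · `….dVIotaLetters`) (`HOME/mc/pub-hodgecm-mc-binder-2/g13/pkg/HodgeCM/Model/HypCensus/KappaLetters.lean`, md5 7608fe6cd35a, 187 lines);
landed by the gen-17 packager (p-g17) in gate run 45 as `HodgeCM/Model/HypCensus/KappaLetters.lean` (verbatim).
-/
/-
Copyright (c) 2026. All rights reserved.
Released under Apache 2.0 license as described in the file LICENSE.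
-/
import Summits.HodgeConjecture.HodgeCM.Model.HypCensus.KappaPlace

/-!
# (V-val) REDUCED TO THE `ι₁` LETTERS: `hκ ⟸ hκ₁ + the (S-norm) type normalisation off ι₁`

Binder-2 lineage, rows 18/19 (`hyp12`/`hyp34`).  The rows-18/19 residual `hκ` is the identity of two CHARACTERS of the compact group
`Π_w U(V⁺_w) × U(V⁻_w) ≃* K_∞` (#62 `lettEquiv`): this leaf packages the four factors as monoid homomorphisms `VLetterFam V →* ℂˣ`
(`etaLetters`, `charLetters`, `dVIotaLetters`, `kappaLetters`), so that `hκ` is the equation `etaLetters · charLetters · dVIotaLetters =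
kappaLetters`, which holds iff it holds on every single-place family `mulSingle b x` (Mathlib `MonoidHom.pi_ext`).  Off `ι₁` it
holds by #72 `hκ_lettInv_mulSingle_of_type` under the (S-norm) normalisation; so

* **`hκ_of_iota_of_type`**: E's `hκ` (verbatim, at `η = (χ_V∘det_V)·(χ_W∘det_W)`, `χ_V` of type `n_V`) FROM
  (i) `n_V (w(b)) = −pairVacExponent b` at every real `b ≠ v₁` and (ii) `hκ₁`: the same identity on the `ι₁`-letters `mulSingle v₁ x` ONLY
  (`x ∈ U(2) × U(1)`: one identity between characters of `U(2) × U(1)`).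

RESIDUAL of (V-val) after this leaf: `hκ₁` (the `ι₁` slot: the pair's vacuum exponents at `ι₁` against `archKappa = det A · d⁻²` and
`dVIota`), plus the cross-lane consistency of normalisation (i) with the S side's (`pairVacExponent b` vs the line exponents — the see-saw
junction, carch-1 (Λ)).  [GelbartRogawski1991 §3.1 Remark p. 457; folklore]  Nothing here is a claim of PerL/QW8.
-/

noncomputable section

open NumberField NumberField.InfinitePlace IsDedekindDomain
open scoped Matrix Classical TensorProduct
open MvPolynomial
open Literature.NumberTheory.Automorphic Literature.NumberTheory.Automorphic.UnitaryGroup Literature.NumberTheory.Weil1964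
open Literature.RepresentationTheory.KonnoKonno2007 Literature.RepresentationTheory.KonnoKonno2007.RealDualPair
open Literature.NumberTheory.GelbartRogawski1991 Literature.NumberTheory.GelbartRogawski1991.UnitaryDualPair
open Literature.Analysis.SegalBargmann
open HodgeCM HodgeCM.Model HodgeCM.Adelic

namespace HodgeCM.Model.HypCensus

section Homs

variable {L : CMField} {ι₁ : L →+* ℂ} (V : HermSpace3 L ι₁) (S : StubTree.SeesawDatum L)
variable
  (hGR : (cmSplittingDatum (L : Type) finProdFinEquiv (frameD V) (frameD_real V) (frameD_ne V) (dW S) (dW_real S) (dW_ne S)).CompatibleSplitting)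
  (η : CMAdelic (L : Type) (frameD V) × CMAdelic (L : Type) (dW S) →* ℂˣ)
  (hW : (∀ j, 0 < (ι₁ ((dW S) j)).re) ∨ ∀ j, (ι₁ ((dW S) j)).re < 0)

/-- `kPair` through the inverse lettering, as a hom `Π_w U(V⁺_w) × U(V⁻_w) →* U(V)(𝔸) × U(W)(𝔸)`. -/
def kPairLetters : VLetterFam V →* CMAdelic (L : Type) (frameD V) × CMAdelic (L : Type) (dW S) :=
  (archProdHom (↥(maximalRealSubfield L)) (L : Type) (IsCMField.complexConj L) 3 2 (Matrix.diagonal (frameD V)) (Matrix.diagonal (dW S))).comp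
    ((kPairHom V S).comp (lettInv V S))

/-- (Ported verbatim from the HodgeCMPerL package; no docstring in the source.) -/
theorem kPairLetters_apply (a : VLetterFam V) :
    kPairLetters V S a = kPair V S ι₁ V.sylvesterFrame (sylvesterFrame_formCongr V) (lettInv V S a) := rfl

/-- **the `η`-factor of (V-val)** as a character of the letters. -/
def etaLetters : VLetterFam V →* ℂˣ := η.comp (kPairLetters V S)

/-- (Ported verbatim from the HodgeCMPerL package; no docstring in the source.) -/
theorem etaLetters_apply (a : VLetterFam V) :
    etaLetters V S η a = η (kPair V S ι₁ V.sylvesterFrame (sylvesterFrame_formCongr V) (lettInv V S a)) := rfl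

/-- **the letter-character factor of (V-val)** as a `ℂˣ`-valued character of the letters. -/
def charLetters : VLetterFam V →* ℂˣ := Circle.toUnits.comp ((pinLetterChar V S hGR hW).comp (kVLettersHom V S))

/-- (Ported verbatim from the HodgeCMPerL package; no docstring in the source.) -/
theorem coe_charLetters_apply (a : VLetterFam V) :
    ((charLetters V S hGR hW a : ℂˣ) : ℂ) = ((pinLetterChar V S hGR hW (kVLetters V S a) : Circle) : ℂ) := rfl

/-- **the `archKappa`-factor of (V-val)** as a character of the letters. -/
def kappaLetters : VLetterFam V →* ℂˣ :=
  (UnitaryGroup.archKappa (L : Type) V.Hm ι₁ V.sylvesterFrame (sylvesterFrame_formCongr V)).comp (lettInv V S)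

/-- (Ported verbatim from the HodgeCMPerL package; no docstring in the source.) -/
theorem kappaLetters_apply (a : VLetterFam V) :
    kappaLetters V S a = UnitaryGroup.archKappa (L : Type) V.Hm ι₁ V.sylvesterFrame (sylvesterFrame_formCongr V) (lettInv V S a) := rfl

/-! ### `dVIota` is a character -/

/-- `vcMatrix` reverses products. -/
theorem vcMatrix_mul' {P' : Type} [Fintype P'] [DecidableEq P'] {n : ℕ} (eA : Fin n ≃ P') (a b : Matrix P' P' ℂ) :
    vcMatrix eA (a * b) = vcMatrix eA b * vcMatrix eA a := by
  rw [vcMatrix_eq, vcMatrix_eq, vcMatrix_eq, ← Matrix.submatrix_mul_equiv a b (eA : Fin n → P') eA (eA : Fin n → P'), Matrix.transpose_mul]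

/-- `dVIota` is multiplicative. -/
theorem dVIota_mul
    (x y : Matrix.unitaryGroup (PosIdx (cmXV (L : Type) (frameD V) (frameD_real V) ι₁ (cmPlace (L : Type) ι₁))) ℂ ×
      Matrix.unitaryGroup (NegIdx (cmXV (L : Type) (frameD V) (frameD_real V) ι₁ (cmPlace (L : Type) ι₁))) ℂ) :
    dVIota V S (x * y) = dVIota V S x * dVIota V S y := by
  by_cases hR : ∀ j, 0 < cmXW (L : Type) (frameD V) (dW S) (dW_real S) ι₁ (cmPlace (L : Type) ι₁) j
  · rw [dVIota_eq_det_of_pos V S hR, dVIota_eq_det_of_pos V S hR, dVIota_eq_det_of_pos V S hR, Prod.fst_mul, Submonoid.coe_mul,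
      vcMatrix_mul', Matrix.det_mul, mul_comm]
  · rw [dVIota_eq_det_of_neg V S hR, dVIota_eq_det_of_neg V S hR, dVIota_eq_det_of_neg V S hR, Prod.fst_mul, Submonoid.coe_mul,
      vcMatrix_mul', show ∀ M N : Matrix (Fin 2) (Fin 2) ℂ, (M * N).map star = M.map star * N.map star from fun M N => by
        rw [show (star : ℂ → ℂ) = ⇑(starRingEnd ℂ) from rfl, Matrix.map_mul], Matrix.det_mul, mul_comm]

/-- `dVIota` never vanishes. -/
theorem dVIota_ne_zero
    (x : Matrix.unitaryGroup (PosIdx (cmXV (L : Type) (frameD V) (frameD_real V) ι₁ (cmPlace (L : Type) ι₁))) ℂ ×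
      Matrix.unitaryGroup (NegIdx (cmXV (L : Type) (frameD V) (frameD_real V) ι₁ (cmPlace (L : Type) ι₁))) ℂ) :
    dVIota V S x ≠ 0 := by
  intro h
  have h1 := dVIota_mul V S x x⁻¹
  rw [mul_inv_cancel, dVIota_one, h, zero_mul] at h1
  exact one_ne_zero h1

/-- **the `dVIota`-factor of (V-val)** as a character of the letters (`a ↦ dVIota (a v₁)`). -/
def dVIotaLetters : VLetterFam V →* ℂˣ where
  toFun a := Units.mk0 (dVIota V S (a (cmPlace (L : Type) ι₁))) (dVIota_ne_zero V S _)
  map_one' := Units.ext (by rw [Units.val_mk0, Pi.one_apply, dVIota_one, Units.val_one])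
  map_mul' a b := Units.ext (by rw [Units.val_mk0, Units.val_mul, Units.val_mk0, Units.val_mk0, Pi.mul_apply, dVIota_mul])

/-- (Ported verbatim from the HodgeCMPerL package; no docstring in the source.) -/
theorem coe_dVIotaLetters_apply (a : VLetterFam V) : ((dVIotaLetters V S a : ℂˣ) : ℂ) = dVIota V S (a (cmPlace (L : Type) ι₁)) := rfl

/-- **(V-val) IS an identity of characters of the letters**: `hκ ↔ etaLetters · charLetters · dVIotaLetters = kappaLetters`. -/
theorem hκ_iff_letters :
    (∀ k : ↥(KInfty V),
      ((η (kPair V S ι₁ V.sylvesterFrame (sylvesterFrame_formCongr V) k) : ℂˣ) : ℂ) *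
          ((pinLetterChar V S hGR hW (kVLetters V S (lett V S k)) : Circle) : ℂ) * dVIota V S (lett V S k (cmPlace (L : Type) ι₁)) =
        ((UnitaryGroup.archKappa (L : Type) V.Hm ι₁ V.sylvesterFrame (sylvesterFrame_formCongr V) k : ℂˣ) : ℂ)) ↔
      etaLetters V S η * charLetters V S hGR hW * dVIotaLetters V S = kappaLetters V S := by
  constructor
  · intro h
    ext a
    have hk := h (lettInv V S a)
    rw [lett_lettInv] at hk
    rw [MonoidHom.mul_apply, MonoidHom.mul_apply, Units.val_mul, Units.val_mul, etaLetters_apply, coe_charLetters_apply,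
      coe_dVIotaLetters_apply, kappaLetters_apply]
    exact hk
  · intro h k
    have ha := congrArg (fun f : VLetterFam V →* ℂˣ => ((f (lett V S k) : ℂˣ) : ℂ)) h
    simp only [MonoidHom.mul_apply, Units.val_mul, etaLetters_apply, coe_charLetters_apply, coe_dVIotaLetters_apply, kappaLetters_apply,
      lettInv_lett] at ha
    exact ha

end Homs

/-! ## (V-val) from its `ι₁` letters and the type normalisation -/

section Val

variable {L : CMField} {ι₁ : L →+* ℂ} (V : HermSpace3 L ι₁) (S : StubTree.SeesawDatum L)
variable
  (hGR : (cmSplittingDatum (L : Type) finProdFinEquiv (frameD V) (frameD_real V) (frameD_ne V) (dW S) (dW_real S) (dW_ne S)).CompatibleSplitting)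
  (hW : (∀ j, 0 < (ι₁ ((dW S) j)).re) ∨ ∀ j, (ι₁ ((dW S) j)).re < 0)
variable (χV χW : ContinuousMonoidHom
  (Literature.NumberTheory.Automorphic.relNormOneIdeles (↥(maximalRealSubfield L)) (L : Type) ⧸
    Literature.NumberTheory.Automorphic.relNormOneRat (↥(maximalRealSubfield L)) (L : Type)) Circle)
variable {nV : InfinitePlace (L : Type) → ℤ}

/-- **(V-val) FROM ITS `ι₁` LETTERS.**  At E's `η = (χ_V∘det_V)·(χ_W∘det_W)` with `χ_V` of archimedean type `n_V` normalised by
`n_V (w(b)) = −pairVacExponent b` at every real `b ≠ v₁`: if the (V-val) identity holds on the `ι₁`-letters `lettInv (mulSingle v₁ x)`,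
`x ∈ U(V⁺_{v₁}) × U(V⁻_{v₁})`, then it holds on ALL of `K_∞` — the hypothesis `hκ` of #51/#61/#70/#71 VERBATIM. -/
theorem hκ_of_iota_of_type (hnV : UnitaryLineChar.HasArchType (L : Type) χV nV)
    (hn : ∀ b : {v : InfinitePlace ↥(maximalRealSubfield L) // v.IsReal}, b ≠ cmPlace (L : Type) ι₁ →
      nV (cmPlaceOver (L : Type) b).1 = -pairVacExponent V S hGR hW b)
    (hκ₁ : ∀ x : Matrix.unitaryGroup (PosIdx (cmXV (L : Type) (frameD V) (frameD_real V) ι₁ (cmPlace (L : Type) ι₁))) ℂ ×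
        Matrix.unitaryGroup (NegIdx (cmXV (L : Type) (frameD V) (frameD_real V) ι₁ (cmPlace (L : Type) ι₁))) ℂ,
      ((cmDetTwistChar (L : Type) (frameD V) (frameD_ne V) (dW S) (dW_ne S) (charOfUnitaryLineChar (L : Type) χV)
            (charOfUnitaryLineChar (L : Type) χW)
            (kPair V S ι₁ V.sylvesterFrame (sylvesterFrame_formCongr V)
              (lettInv V S (Pi.mulSingle (cmPlace (L : Type) ι₁) x))) : ℂˣ) : ℂ) *
          ((pinLetterChar V S hGR hW (kVLetters V S (Pi.mulSingle (cmPlace (L : Type) ι₁) x)) : Circle) : ℂ) * dVIota V S x =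
        ((UnitaryGroup.archKappa (L : Type) V.Hm ι₁ V.sylvesterFrame (sylvesterFrame_formCongr V)
          (lettInv V S (Pi.mulSingle (cmPlace (L : Type) ι₁) x)) : ℂˣ) : ℂ))
    (k : ↥(KInfty V)) :
    ((cmDetTwistChar (L : Type) (frameD V) (frameD_ne V) (dW S) (dW_ne S) (charOfUnitaryLineChar (L : Type) χV)
          (charOfUnitaryLineChar (L : Type) χW) (kPair V S ι₁ V.sylvesterFrame (sylvesterFrame_formCongr V) k) : ℂˣ) : ℂ) *
        ((pinLetterChar V S hGR hW (kVLetters V S (lett V S k)) : Circle) : ℂ) * dVIota V S (lett V S k (cmPlace (L : Type) ι₁)) =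
      ((UnitaryGroup.archKappa (L : Type) V.Hm ι₁ V.sylvesterFrame (sylvesterFrame_formCongr V) k : ℂˣ) : ℂ) := by
  have H : etaLetters V S (cmDetTwistChar (L : Type) (frameD V) (frameD_ne V) (dW S) (dW_ne S) (charOfUnitaryLineChar (L : Type) χV)
        (charOfUnitaryLineChar (L : Type) χW)) * charLetters V S hGR hW * dVIotaLetters V S = kappaLetters V S := by
    refine MonoidHom.pi_ext fun b x => ?_
    apply Units.ext
    rw [MonoidHom.mul_apply, MonoidHom.mul_apply, Units.val_mul, Units.val_mul]
    rw [coe_charLetters_apply, coe_dVIotaLetters_apply]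
    rw [kappaLetters_apply]
    rw [etaLetters_apply]
    by_cases hb : b = cmPlace (L : Type) ι₁
    · subst hb
      have h := hκ₁ x
      convert h using 2
      rw [Pi.mulSingle_eq_same]
    · have h := hκ_lettInv_mulSingle_of_type V S hGR hW χV χW hnV b hb (hn b hb) x
      convert h using 2
  exact (hκ_iff_letters V S hGR _ hW).mpr H k

end Val

end HodgeCM.Model.HypCensus

end
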